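import Mathlib
import HarnessLib
import Summits.Langlands.Langlands.Theses.SkinnerWilesDefectOne
import Literature.NumberTheory.Automorphic.POrdinaryHeckeAlgebraGL2

/-!
# Route `SkinnerWilesDefectOne`, crux `ReducibleOrdinaryProModular` (stmt-Langlands-12919): vocabulary of the
# line `generic-eisenstein-rigidity` — the reducibility ideal of a two-dimensional determinant

Route-posited objects file (D-0016 `<Route><Crux>Defs`-type, same convention as the sibling
`SkinnerWilesDefectOneReducibleOrdinaryProModularDefs.lean` of line `steinberg-hyperplane`) for the checked skeleton
`Cruxes/ReducibleOrdinaryProModular/Lines/generic_eisenstein_rigidity.lean` (lead skeleton v5, registered 2026-08-16 by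
`ledger skeleton check`; stubs `stub_eisensteinDivisor`, `stub_cuspidalEisensteinCongruence`, `stub_rigidityAtGenericPoint`,
with `stub_typeDSetup` landed).  NOTHING IS ASSERTED: the one definition below is DATA (an ideal), consumed in the
types of the three open stubs and of their helper files; it is declared in the skeleton's namespace
`Summit.Langlands.Langlands.Cruxes.ReducibleOrdinaryProModular.GenericEisensteinRigidity` so that a landed stub reads
byte-identically to its registration (the skeleton is reshaped to import this file in place of its inline copy).

* `redIdeal D` — the **reducibility ideal** of a two-dimensional determinant `D : PseudoRep2 G A`
  (Bellaïche–Chenevier): the infimum of the ideals `I ≤ A` modulo which `D` is the sum of two `A/I`-valued characters.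
  For `D = det ρ_𝒟` of a universal nearly ordinary deformation with `ρ̄` a non-split extension of distinct characters
  this is Skinner–Wiles' ideal `I` of the lower-left entries, `V(I) = Spec R_𝒟^red` (proved for the tree's interface
  ring in the helper file `…GenericEisensteinReducibleLocusAux`); for the determinant of a Hecke algebra it is the
  Eisenstein ideal along the family.
* `redIdeal_le` — the defining inequality (`sInf_le`), the certificate through which this file lands.

References: J. Bellaïche, G. Chenevier, *Families of Galois representations and Selmer groups*, Astérisque 324 (2009),
§1.5; C. M. Skinner, A. J. Wiles, Publ. Math. IHÉS 89 (1999), §2.2; T. Berger, K. Klosin, Math. Ann. 355 (2013), §5.2.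
-/

namespace Summit.Langlands.Langlands.Cruxes.ReducibleOrdinaryProModular.GenericEisensteinRigidity

-- `Summit.Langlands.Langlands.…` (summit = sub-problem name, D-0017 layout) trips `dupNamespace` on every decl.
set_option linter.dupNamespace false
set_option autoImplicit false

open Literature.NumberTheory.Automorphic

noncomputable section

/-- **Reducibility ideal** of a two-dimensional determinant `D` over `A` (Bellaïche–Chenevier): the
infimum of the ideals `I` modulo which `D` is a sum of two `A/I`-valued characters.  For `D = det ρ_𝒟`
with `ρ̄` a non-split extension of distinct characters this is Skinner–Wiles' ideal `I` generated by the
lower-left entries (`V(I) = Spec R_𝒟^red =` the reducible locus, SW99 §2.2); for the determinant of a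
Hecke algebra it is the Eisenstein (congruence) ideal along the family.
[cite: SkinnerWiles1999, §2.2] [cite: BergerKlosin2012, §5.2] -/
def redIdeal {G : Type*} {A : Type*} [Group G] [CommRing A] (D : PseudoRep2 G A) : Ideal A :=
  sInf {I : Ideal A | ∃ χ₁ χ₂ : G →* (A ⧸ I)ˣ,
    D.map (Ideal.Quotient.mk I) = PseudoRep2.ofCharacters χ₁ χ₂}

/-- `redIdeal D ≤ J` as soon as `D mod J` is a sum of two characters (the defining inequality; registered
certificate of this vocabulary file). [folklore] -/
theorem redIdeal_le {Γ : Type*} [Group Γ] {A : Type*} [CommRing A] {D : PseudoRep2 Γ A} {J : Ideal A}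
    (h : ∃ χ₁ χ₂ : Γ →* (A ⧸ J)ˣ, D.map (Ideal.Quotient.mk J) = PseudoRep2.ofCharacters χ₁ χ₂) :
    redIdeal D ≤ J :=
  sInf_le h

end

end Summit.Langlands.Langlands.Cruxes.ReducibleOrdinaryProModular.GenericEisensteinRigidity
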